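/-
Copyright (c) 2026 the pub-hodgecm-mathlib formalisation cell (harness21).  Prover seat hodgecm-mathlib-LH4-p06 (g5), Track A «(D-RAM) FOUR-FRAME», unit U2H, census leaf
(ρ2b′-X) `stub_U2H_fixedPointCensus_typeTwo_unit0` — SOCKET (C) `orderCountCensusC` (type RamM), hand (C-2) «DEP∕TOP dischargers of ★ p857711's `hvGen ∕ hvOff ∕ hvTop`»
(LH4-p04 (g5) SOCKET (C) LEAD LINE #1, dealer LH4-plan (g12) WORD #30), FILE (V): `hvGen`, `hvOff`, and the `hvTop` VALUE against any bit.  2026-09-04.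
-/
import Summits.HodgeConjecture.HodgeConjecture.Theorems.F0P3cDyRamToricLevelCensusRamMTop          -- ★ p857665∕741 (this seat): the (D3) values (`…_explicit_even∕odd∕low_of_ramified`); brings ★ TopPrep, ★ RamMDep
import HarnessLib

/-!
# T5c (C-2, V): the LITERAL `hvGen ∕ hvOff` letters of ★ `toricCensusSum_ramM` and the `hvTop` VALUE for `vP∕vM j a := #levelSetDep(j,a;μ)`

Cell `hodgecm-mathlib` (D-0151), FLOOR 0, crux H413 = `stmt-HodgeConjecture-24833`; squad F0∕P3c∕LH4; lane `--supports stmt-HodgeConjecture-24833 --as helper` (count-neutral).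
THEOREMS ONLY (no `def`, no instance, no notation, no `sorry`, default heartbeats).  Socket served: LH4-p04 (g5)'s SOCKET (C) `orderCountCensusC`, bricks (C-2) «DEP∕TOP» of his
LEAD LINE #1 — the three depth letters of ★ p857711 `toricCensusSum_ramM` (LH4-p04 (g4)) DISCHARGED for the true tables `vP j a := (#levelSetDep_h(j,a;λ−u) : ℚ)`:
* **`ncard_levelSetDep_cast_eq_of_gen`** ∕ **`ncard_levelSetDep_cast_eq_zero_of_off`** (`hvGen`, `hvOff`; any scalar `h`; ★ RamMDep `levelSetDep_eq_of_generic_ramified` in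
  the census-sum's GEN letter `a ≤ m ∧ (j + a ≤ m ∨ (2a ≤ m ∧ j + a ≤ jλ))`);
* **`ncard_levelSetDep_top_cast_eq_of_bit`** — the (D3) VALUE on the diagonal `j + m = jλ + a`, `¬GEN`, against ANY proposition equivalent to the literal (D3) bit:
  `q^j` below K♮-level `0` (`j + a < m + s0`, ★ `…_low_`), else `(if 2g ≤ k′+1 then 2 else 1)·q^{j − (k′+1)∕2}`, `k′ = j + a − m − s0` (★ `…_even_ ∕ …_odd_`, `2 ∣ q`);
The sequel `…RamMTopCellsHvTop` substitutes `Bit :=` ★ p857711's `hvTop` bit via the ★ bridges p857886 and the law `twistNear_iff_censusBit` ∕ `anchoredNear_iff_censusBit`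
(`…RamMTopCellsLaw`), giving `hvTop` VERBATIM with `ε = 1` ∕ `ε = −1` read as side letters.
HONEST LABEL.  Count-neutral (`--supports`); unconditional local algebra; nothing of (ρ2b′-X) is asserted — `HC_CM` is proved only modulo the 7 printed citations (2 remaining named
inputs: hLiu418 = `stmt-HodgeConjecture-24832`, h413 = `stmt-HodgeConjecture-24833`) until rung 0 closes.

## References
* [Flicker1998UnitaryFL] Y. Z. Flicker, *Elementary proof of the fundamental lemma for a unitary group*, Canad. J. Math. 50 (1998): Prop. 7 p. 84 (the level tables).
* [Kottwitz1986BaseChangeUnits] R. E. Kottwitz, *Base change for unit elements of Hecke algebras*, Compositio Math. 60 (1986): §1 pp. 240–241.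
* [Jacobowitz1962] R. Jacobowitz, *Hermitian forms over local fields*, Amer. J. Math. 84 (1962): §4.
* [Serre1979] J.-P. Serre, *Local Fields*, GTM 67 (1979): Ch. V §3 Prop. 5, Cor. 3.
-/

set_option autoImplicit false

noncomputable section

namespace Summit.HodgeConjecture.HodgeConjecture.Cruxes.H413.F0P3cDyRamToricLevelCensusRamM

open WithZero IsLocalRing
open scoped Valued
open Literature.NumberTheory.Automorphic.UnitaryThreeFourFrame (IsRamifiedQuadraticDatum)
open Literature.NumberTheory.LocalFields.QuadraticOrder Literature.NumberTheory.LocalFields.WildQuadraticDatum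
open Summit.HodgeConjecture.HodgeConjecture.Cruxes.H413.F0P3cDyRamToricCensusDefs

variable {K : Type} [Field K] [Valued K ℤᵐ⁰] {ρ Θ τ : K →+* K} {α ϖE h : K} {dρ t dτ tτ : ℕ}
variable {K' : Type*} [Field K'] [Valued K' ℤᵐ⁰] {σ' : K' →+* K'} {π' : K'} {d' : ℕ}

/-! ## §1 Two casts -/

/-- `(q^j ∕ q^n : ℕ) = q^{j−n}` in `ℚ` (`n ≤ j`, `0 < q`). [cite: Flicker1998UnitaryFL, Prop. 7 p. 84] -/
theorem cast_pow_div_pow {q j n : ℕ} (hq : 0 < q) (hn : n ≤ j) : ((q ^ j / q ^ n : ℕ) : ℚ) = (q : ℚ) ^ (j - n) := by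
  rw [Nat.pow_div hn hq]; push_cast; rfl

/-- `(q^j ∕ (q^n∕2) : ℕ) = 2·q^{j−n}` in `ℚ` (`2 ∣ q`, `1 ≤ n ≤ j`). [cite: Flicker1998UnitaryFL, Prop. 7 p. 84] -/
theorem cast_pow_div_half_pow {q j n : ℕ} (hq : 0 < q) (hq2 : 2 ∣ q) (hn1 : 1 ≤ n) (hn : n ≤ j) :
    ((q ^ j / (q ^ n / 2) : ℕ) : ℚ) = 2 * (q : ℚ) ^ (j - n) := by
  obtain ⟨e, he⟩ : 2 ∣ q ^ n := hq2.trans (dvd_pow_self q (by omega))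
  have he0 : 0 < e := by have hp : 0 < q ^ n := pow_pos hq n; rw [he] at hp; omega
  have hj : q ^ j = 2 * q ^ (j - n) * e := by
    rw [← pow_sub_mul_pow q hn, he]; ring
  rw [he, Nat.mul_div_cancel_left e (by norm_num), hj, Nat.mul_div_cancel _ he0]; push_cast; rfl

/-! ## §2 `hvGen` and `hvOff` (★ RamMDep in the census-sum's GEN letter) -/

/-- **`hvGen`**: on a GENERIC cell (`a ≤ m ∧ (j + a ≤ m ∨ (2a ≤ m ∧ j + a ≤ jλ))`, `j ≤ jλ`) every lattice of the level passes: `#levelSetDep(j,a;μ) = #levelSet(j,a)` (cast to `ℚ`).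
[cite: Jacobowitz1962, §4] [cite: Kottwitz1986BaseChangeUnits, §1 pp. 240–241] -/
theorem ncard_levelSetDep_cast_eq_of_gen (hD : IsRamifiedQuadraticDatum ρ α dρ t) (hΘΘ : ∀ x, Θ (Θ x) = x) (hΘρ : ∀ x, Θ (ρ x) = ρ (Θ x))
    (hvΘ : ∀ x, Valued.v (Θ x) = Valued.v x) (hρϖ : ρ ϖE = ϖE) (hϖE : Valued.v ϖE = exp (-2 : ℤ)) (hh : h ≠ 0)
    {μ : K} {m jl : ℕ} (hμ : Valued.v μ = Valued.v ϖE ^ m) (hjl : Valued.v (μ - ρ μ) = Valued.v (ϖE ^ jl * (α - ρ α)))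
    {j a : ℕ} (hj : j ≤ jl) (hgen : a ≤ m ∧ (j + a ≤ m ∨ (2 * a ≤ m ∧ j + a ≤ jl))) :
    ((levelSetDep ρ Θ α ϖE h j a μ).ncard : ℚ) = ((levelSet ρ Θ α ϖE h j a).ncard : ℚ) := by
  have hgen' : a ≤ m ∧ (j ≤ m - a ∨ (2 * a ≤ m ∧ j + a ≤ jl)) := ⟨hgen.1, hgen.2.imp_left fun h1 => by omega⟩
  rw [levelSetDep_eq_of_generic_ramified hD hΘΘ hΘρ hvΘ hρϖ hϖE hh hμ hjl hj (Or.inr hgen'), if_pos hgen']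

/-- **`hvOff`**: on a NON-generic cell OFF the coincidence diagonal (`j + m ≠ jλ + a`, `j ≤ jλ`) no lattice passes: `#levelSetDep(j,a;μ) = 0`.
[cite: Jacobowitz1962, §4] [cite: Kottwitz1986BaseChangeUnits, §1 pp. 240–241] -/
theorem ncard_levelSetDep_cast_eq_zero_of_off (hD : IsRamifiedQuadraticDatum ρ α dρ t) (hΘΘ : ∀ x, Θ (Θ x) = x) (hΘρ : ∀ x, Θ (ρ x) = ρ (Θ x))
    (hvΘ : ∀ x, Valued.v (Θ x) = Valued.v x) (hρϖ : ρ ϖE = ϖE) (hϖE : Valued.v ϖE = exp (-2 : ℤ)) (hh : h ≠ 0)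
    {μ : K} {m jl : ℕ} (hμ : Valued.v μ = Valued.v ϖE ^ m) (hjl : Valued.v (μ - ρ μ) = Valued.v (ϖE ^ jl * (α - ρ α)))
    {j a : ℕ} (hj : j ≤ jl) (hng : ¬ (a ≤ m ∧ (j + a ≤ m ∨ (2 * a ≤ m ∧ j + a ≤ jl)))) (hoff : j + m ≠ jl + a) :
    ((levelSetDep ρ Θ α ϖE h j a μ).ncard : ℚ) = 0 := by
  have hng' : ¬ (a ≤ m ∧ (j ≤ m - a ∨ (2 * a ≤ m ∧ j + a ≤ jl))) := fun h1 => hng ⟨h1.1, h1.2.imp_left fun h2 => by omega⟩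
  rw [levelSetDep_eq_of_generic_ramified hD hΘΘ hΘρ hvΘ hρϖ hϖE hh hμ hjl hj (Or.inl hoff), if_neg hng', Set.ncard_empty, Nat.cast_zero]

/-! ## §3 `hvTop`: the (D3) value against any proposition equivalent to the literal bit -/

open scoped Classical in
/-- **THE (D3) VALUE IN THE CENSUS-SUM'S LETTERS.**  Frame of ★ `…RamMTop` §4–§5 (ρ-datum, `Θ`-datum, third-field package with `#𝓀[K′] = q`, `hFN`, `|ϖE| = exp(−2)`, `ρϖE = ϖE`,
`#𝓀_M = q`, `2 ∣ q`; scalar `h ≠ 0`, `|h| = exp(−v_h)`; tokens `|μ| = |ϖE|^m`, `|μ − ρμ| = |ϖE^{jλ}(α − ρα)|`; dictionary `dΘ = 2g`, `dτ = 2s0`, `2d′ = d_ρ + dτ`; the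
diagonal class index `k₀` with `v_h + d_ρ + 2k₀ + 2jλ = 2m`).  On a cell of the diagonal `j + m = jλ + a` with `¬GEN`, for ANY proposition `Bit` equivalent to the literal
(D3) bit `∃ ω₁ ∈ U_M, |1 + (η∕κ)·t(ω₁)| ≤ exp(2m − 2a − 2j − d_ρ)`:
`#levelSetDep(j,a;μ) = if Bit then (if j + a < m + s0 then q^j else (if 2g ≤ k′+1 then 2 else 1)·q^{j − (k′+1)∕2}) else 0`, `k′ = j + a − m − s0`.
[cite: Flicker1998UnitaryFL, Prop. 7 p. 84] [cite: Serre1979, Ch. V §3 Cor. 3] [cite: Jacobowitz1962, §4] -/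
theorem ncard_levelSetDep_top_cast_eq_of_bit [CompleteSpace K] [IsDiscreteValuationRing 𝒪[K]] [Finite 𝓀[K]] [IsDiscreteValuationRing 𝒪[K']] [Finite 𝓀[K']]
    (hD : IsRamifiedQuadraticDatum ρ α dρ t) (hΘρ : ∀ x, Θ (ρ x) = ρ (Θ x)) (hvΘ : ∀ x, Valued.v (Θ x) = Valued.v x)
    (hϖE : Valued.v ϖE = exp (-2 : ℤ)) (hρϖ : ρ ϖE = ϖE) {q : ℕ} (hq : Nat.card 𝓀[K] = q) (hq' : Nat.card 𝓀[K'] = q) (hq2 : 2 ∣ q)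
    (hσ' : ∀ x, σ' (σ' x) = x) (hvσ' : ∀ x, Valued.v (σ' x) = Valued.v x) (hfix' : ∀ x : K', σ' x = x → x ≠ 0 → ∃ n : ℤ, Valued.v x = exp (2 * n))
    (hπ' : Valued.v π' = exp (-1 : ℤ)) (hdd' : Valued.v (π' - σ' π') = Valued.v π' ^ d')
    (jK : K' →+* K) (hjle : ∀ x y : K', Valued.v (jK x) ≤ Valued.v (jK y) ↔ Valued.v x ≤ Valued.v y) (hjΘ : ∀ x, Θ (jK x) = jK x)
    (hjfix : ∀ z : K, Θ z = z → ∃ x, jK x = z) (hjσ : ∀ x, jK (σ' x) = ρ (jK x)) (hjπ : Valued.v (jK π') = exp (-2 : ℤ))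
    {ϖ : K} {dΘ tΘ : ℕ} (hDΘ : IsRamifiedQuadraticDatum Θ ϖ dΘ tΘ)
    (hFN : ∀ f : K, ρ f = f → Θ f = f → Valued.v f = 1 → ∃ x : K, x * Θ x = f)
    (hh : h ≠ 0) {vh : ℤ} (hvh : Valued.v h = exp (-vh))
    {μ : K} {m jl : ℕ} (hμ : Valued.v μ = Valued.v ϖE ^ m) (hjl : Valued.v (μ - ρ μ) = Valued.v (ϖE ^ jl * (α - ρ α)))
    {g s0 : ℕ} (hg : dΘ = 2 * g) (hs0 : dτ = 2 * s0) (hd' : 2 * d' = dρ + dτ)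
    {k₀ : ℤ} (hk₀ : vh + dρ + 2 * k₀ + 2 * jl = 2 * m)
    {j a : ℕ} (hj : j ≤ jl) (hng : ¬ (a ≤ m ∧ (j + a ≤ m ∨ (2 * a ≤ m ∧ j + a ≤ jl)))) (hdiag : j + m = jl + a)
    (Bit : Prop)
    (hbit : (∃ ω₁ : Kˣ, Valued.v (ω₁ : K) = 1 ∧
        Valued.v (1 + ρ h / h * (ρ (α ^ k₀ * Θ (α ^ k₀)) / (α ^ k₀ * Θ (α ^ k₀))) / (ρ μ / μ) * (ρ ((ω₁ : K) * Θ ω₁) / ((ω₁ : K) * Θ ω₁))) ≤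
          exp (2 * (m : ℤ) - 2 * a - 2 * j - dρ)) ↔ Bit) :
    ((levelSetDep ρ Θ α ϖE h j a μ).ncard : ℚ) =
      if Bit then (if j + a < m + s0 then (q : ℚ) ^ j else (if 2 * g ≤ j + a - m - s0 + 1 then 2 else 1) * (q : ℚ) ^ (j - (j + a - m - s0 + 1) / 2)) else 0 := by
  have hΘΘ := hDΘ.1
  have hvρ := hD.2.1
  have hq0 : 0 < q := Nat.pos_of_ne_zero (card_residueField_ne_zero hq)
  have hg1 : 1 ≤ g := by have h1 := hDΘ.2.2.2.2.2.1; omega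
  have htop : m + 1 ≤ 2 * a := by omega
  have hk₀' : vh + dρ + 2 * k₀ + 2 * j = 2 * a := by omega
  obtain ⟨U, hU⟩ := Literature.NumberTheory.LocalFields.WildQuadraticDatum.exists_subgroup_v_eq_one (K := K)
  obtain ⟨H, hH⟩ := exists_subgroup_orderUnits (ρ := ρ) (α := α) hvρ (ϖE ^ j)
  obtain ⟨B, hB⟩ := exists_subgroup_normDepth (Θ := Θ) hvρ hvΘ (exp (2 * (m : ℤ) - 2 * a - 2 * j - dρ))
  by_cases hB0 : Bit
  · rw [if_pos hB0]
    have hχ := hbit.2 hB0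
    by_cases hlow : j + a < m + s0
    · rw [if_pos hlow, ncard_levelSetDep_top_eq_explicit_low_of_ramified hD hΘΘ hΘρ hvΘ hϖE hρϖ hq hσ' hfix' hπ' hdd' jK hjle hjfix hjσ hjπ hh hvh hμ hjl
        hj hdiag htop hk₀' (n := j + a - m + (d' - s0)) (by omega) (by omega) U H B hU hH hB, if_pos hχ]
      push_cast; rfl
    rw [if_neg hlow]
    rcases Nat.even_or_odd (j + a - m - s0) with ⟨n, hn⟩ | ⟨n, hn⟩
    · -- even K♮-level `k′ = 2n`
      rw [ncard_levelSetDep_top_eq_explicit_even_of_ramified hD hΘρ hvΘ hϖE hρϖ hq hq' hσ' hvσ' hfix' hπ' hdd' jK hjle hjΘ hjfix hjσ hjπ hDΘ hFN hh hvh hμ hjl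
        hj hdiag htop hk₀' (n := n) (by omega) U H B hU hH hB, if_pos hχ, show (j + a - m - s0 + 1) / 2 = n by omega]
      by_cases hdn : dΘ ≤ 2 * n + 1
      · rw [if_pos hdn, if_pos (by omega), cast_pow_div_half_pow hq0 hq2 (by omega) (by omega)]
      · rw [if_neg hdn, if_neg (by omega), cast_pow_div_pow hq0 (by omega), one_mul]
    · -- odd K♮-level `k′ = 2n + 1`
      rw [ncard_levelSetDep_top_eq_explicit_odd_of_ramified hD hΘρ hvΘ hϖE hρϖ hq hq' hσ' hvσ' hfix' hπ' hdd' jK hjle hjΘ hjfix hjσ hjπ hDΘ hFN hh hvh hμ hjl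
        hj hdiag htop hk₀' (n := n) (by omega) U H B hU hH hB, if_pos hχ, show (j + a - m - s0 + 1) / 2 = n + 1 by omega]
      by_cases hdn : dΘ ≤ 2 * n + 2
      · rw [if_pos hdn, if_pos (by omega), cast_pow_div_half_pow hq0 hq2 (by omega) (by omega)]
      · rw [if_neg hdn, if_neg (by omega), cast_pow_div_pow hq0 (by omega), one_mul]
  · rw [if_neg hB0, ncard_levelSetDep_top_eq_of_ramified hD hΘΘ hΘρ hvΘ hϖE hρϖ hq hh hvh hμ hjl hj hdiag htop hk₀' U H B hU hH hB,
      if_neg (mt hbit.1 hB0), Nat.cast_zero]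

end Summit.HodgeConjecture.HodgeConjecture.Cruxes.H413.F0P3cDyRamToricLevelCensusRamM

end
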